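import Mathlib
import HarnessLib

/-!
# Crux `WcbcsBcsConstruction`, line `lro-seed-kink-bridge`: stub `stub_subadditiveLimit2D`

Crux item stmt-HubbardSuperconductivity-2010 (route `HubbardSuperconductivity/WeakCouplingBCS`),
line `lro-seed-kink-bridge`. Pure real analysis: **Fekete's lemma along squares, with boundary
terms.** A sequence `a : ℕ → ℝ` (the grand-canonical ground energy of a free-boundary box of
side `L`) with a volume lower bound `a(L) ≥ -cL²`, tiling sub-additivity
`a(kM) ≤ k² a(M) + C k² M` and monotonicity up to a boundary cost `a(L) ≤ a(M) + CL` (`M ≤ L`)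
has a limiting density: `a(L)/L²` converges (to `β = inf_{M ≥ 1} (a(M)/M² + 2C/M)`).

Proof (folklore, Ruelle, *Statistical Mechanics* (1969) §2.1–2.2): `β` is finite by the volume
lower bound; `a(L)/L² ≥ β - 2C/L` gives the lower half. For the upper half pick `M ≥ 1` with
`a(M)/M² + 2C/M < β + ε`; for `N = kM + r` (`k = ⌊N/M⌋`, `r < M`),
`a(N) ≤ a(kM) + CN ≤ k² a(M) + C k² M + CN`, so
`a(N)/N² ≤ (kM/N)² · a(M)/M² + C/M + C/N → a(M)/M² + C/M < β + ε` since `kM/N → 1`.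
No definitions; everything is proved.
-/

set_option linter.dupNamespace false

namespace Summit.HubbardSuperconductivity.HubbardSuperconductivity.Theorems

open Filter
open scoped Topology

/-- **The tiling ratio tends to one**: for `M ≥ 1`, `⌊N/M⌋ M / N → 1` as `N = L + 1 → ∞`
(squeeze between `1 - M/N` and `1`, from `N - M < ⌊N/M⌋ M ≤ N`). [folklore] -/
theorem tendsto_div_mul_cast_div_succ (M : ℕ) (hM : 0 < M) :
    Tendsto (fun L : ℕ => (((L + 1) / M * M : ℕ) : ℝ) / ((L + 1 : ℕ) : ℝ)) atTop (𝓝 1) := by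
  have h0 : Tendsto (fun L : ℕ => (M : ℝ) / ((L + 1 : ℕ) : ℝ)) atTop (𝓝 0) :=
    (tendsto_const_div_atTop_nhds_zero_nat (M : ℝ)).comp (tendsto_add_atTop_nat 1)
  have hlow : Tendsto (fun L : ℕ => 1 - (M : ℝ) / ((L + 1 : ℕ) : ℝ)) atTop (𝓝 1) := by
    have h := (tendsto_const_nhds (x := (1 : ℝ))).sub h0
    rwa [sub_zero] at h
  refine tendsto_of_tendsto_of_tendsto_of_le_of_le hlow tendsto_const_nhds (fun L => ?_)
    (fun L => ?_)
  · -- `1 - M/N ≤ ⌊N/M⌋ M / N`, i.e. `N ≤ ⌊N/M⌋ M + M`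
    have hpos : (0 : ℝ) < ((L + 1 : ℕ) : ℝ) := by positivity
    have hnat : L + 1 ≤ (L + 1) / M * M + M := (Nat.lt_div_mul_add hM).le
    show 1 - (M : ℝ) / ((L + 1 : ℕ) : ℝ) ≤ (((L + 1) / M * M : ℕ) : ℝ) / ((L + 1 : ℕ) : ℝ)
    rw [sub_le_iff_le_add, ← add_div, le_div_iff₀ hpos, one_mul]
    exact_mod_cast hnat
  · -- `⌊N/M⌋ M / N ≤ 1`
    have hpos : (0 : ℝ) < ((L + 1 : ℕ) : ℝ) := by positivity
    show (((L + 1) / M * M : ℕ) : ℝ) / ((L + 1 : ℕ) : ℝ) ≤ 1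
    rw [div_le_one hpos]
    exact_mod_cast Nat.div_mul_le_self (L + 1) M

/-- Stub `stub_subadditiveLimit2D` of the lead's skeleton (crux `WcbcsBcsConstruction`, line
`lro-seed-kink-bridge`). **Fekete's lemma along squares, with boundary terms.** A sequence
`a : ℕ → ℝ` (think: the ground-state energy of a box of side `L`) bounded below by `-cL²`,
tiling-subadditive `a(kM) ≤ k² a(M) + C k² M` and monotone up to a boundary cost
`a(L) ≤ a(M) + C L` (`M ≤ L`) has a limit density `a(L)/L²` (it equals
`inf_{M ≥ 1} (a(M) + 2CM)/M²`). [folklore] -/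
theorem stub_subadditiveLimit2D :
    ∀ (a : ℕ → ℝ) (C c : ℝ), 0 ≤ C →
      (∀ L : ℕ, -c * (L : ℝ) ^ 2 ≤ a L) →
      (∀ k M : ℕ, a (k * M) ≤ (k : ℝ) ^ 2 * a M + C * (k : ℝ) ^ 2 * M) →
      (∀ L M : ℕ, M ≤ L → a L ≤ a M + C * L) →
      ∃ ℓ : ℝ, Tendsto (fun L : ℕ => a (L + 1) / ((L + 1 : ℕ) : ℝ) ^ 2) atTop (𝓝 ℓ) := by
  intro a C c hC hlow hsub hmono
  -- the shifted densities `b M = a(M+1)/(M+1)² + 2C/(M+1)`, whose infimum is the limit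
  set b : ℕ → ℝ := fun M => a (M + 1) / ((M + 1 : ℕ) : ℝ) ^ 2 + 2 * C / ((M + 1 : ℕ) : ℝ)
    with hb
  have hbdd : BddBelow (Set.range b) := by
    refine ⟨-c, ?_⟩
    rintro _ ⟨M, rfl⟩
    have hpos : (0 : ℝ) < ((M + 1 : ℕ) : ℝ) := by positivity
    have h1 : -c ≤ a (M + 1) / ((M + 1 : ℕ) : ℝ) ^ 2 := by
      rw [le_div_iff₀ (by positivity)]
      exact hlow (M + 1)
    have h2 : 0 ≤ 2 * C / ((M + 1 : ℕ) : ℝ) := by positivity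
    show -c ≤ a (M + 1) / ((M + 1 : ℕ) : ℝ) ^ 2 + 2 * C / ((M + 1 : ℕ) : ℝ)
    linarith
  refine ⟨⨅ M, b M, ?_⟩
  rw [tendsto_order]
  refine ⟨fun a' ha' => ?_, fun a' ha' => ?_⟩
  · -- lower half: `β - 2C/(L+1) ≤ a(L+1)/(L+1)²` and `2C/(L+1) → 0`
    have h0 : Tendsto (fun L : ℕ => 2 * C / ((L + 1 : ℕ) : ℝ)) atTop (𝓝 0) :=
      (tendsto_const_div_atTop_nhds_zero_nat (2 * C)).comp (tendsto_add_atTop_nat 1)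
    have h1 : Tendsto (fun L : ℕ => (⨅ M, b M) - 2 * C / ((L + 1 : ℕ) : ℝ)) atTop
        (𝓝 (⨅ M, b M)) := by
      have h := (tendsto_const_nhds (x := ⨅ M, b M)).sub h0
      rwa [sub_zero] at h
    filter_upwards [(tendsto_order.1 h1).1 a' ha'] with L hL
    refine hL.trans_le ?_
    have hβ : (⨅ M, b M) ≤ b L := ciInf_le hbdd L
    have hbL : b L = a (L + 1) / ((L + 1 : ℕ) : ℝ) ^ 2 + 2 * C / ((L + 1 : ℕ) : ℝ) := rfl
    linarith
  · -- upper half: tile the box of side `N = L + 1` by boxes of a good side `M`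
    obtain ⟨M₀, hM₀⟩ := exists_lt_of_ciInf_lt ha'
    set M : ℕ := M₀ + 1 with hM
    have hMpos : 0 < M := Nat.succ_pos M₀
    have hMposR : (0 : ℝ) < (M : ℝ) := by positivity
    have hbM : b M₀ = a M / (M : ℝ) ^ 2 + 2 * (C / (M : ℝ)) := by
      show a M / (M : ℝ) ^ 2 + 2 * C / (M : ℝ) = _
      rw [mul_div_assoc]
    -- the comparison function and its limit
    have hg : Tendsto (fun L : ℕ =>
        ((((L + 1) / M * M : ℕ) : ℝ) / ((L + 1 : ℕ) : ℝ)) ^ 2 * (a M / (M : ℝ) ^ 2) + C / (M : ℝ) +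
          C / ((L + 1 : ℕ) : ℝ)) atTop
        (𝓝 ((1 : ℝ) ^ 2 * (a M / (M : ℝ) ^ 2) + C / (M : ℝ) + 0)) := by
      refine ((((tendsto_div_mul_cast_div_succ M hMpos).pow 2).mul_const _).add_const _).add ?_
      exact (tendsto_const_div_atTop_nhds_zero_nat C).comp (tendsto_add_atTop_nat 1)
    have hlim : (1 : ℝ) ^ 2 * (a M / (M : ℝ) ^ 2) + C / (M : ℝ) + 0 < a' := by
      have hCM : 0 ≤ C / (M : ℝ) := div_nonneg hC hMposR.le
      rw [one_pow, one_mul, add_zero]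
      linarith
    filter_upwards [(tendsto_order.1 hg).2 a' hlim] with L hL
    refine lt_of_le_of_lt ?_ hL
    -- the tiling inequality `a(N)/N² ≤ (kM/N)² · a(M)/M² + C/M + C/N`
    set N : ℕ := L + 1 with hN
    set k : ℕ := N / M with hk
    have hkM : k * M ≤ N := Nat.div_mul_le_self N M
    have h1 : a N ≤ a (k * M) + C * (N : ℝ) := hmono N (k * M) hkM
    have h2 : a (k * M) ≤ (k : ℝ) ^ 2 * a M + C * (k : ℝ) ^ 2 * (M : ℝ) := hsub k M
    have hNpos : (0 : ℝ) < (N : ℝ) := by positivity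
    have hN2 : (0 : ℝ) < (N : ℝ) ^ 2 := by positivity
    have hkMR : (k : ℝ) * (M : ℝ) ≤ (N : ℝ) := by exact_mod_cast hkM
    have i3 : C * (k : ℝ) ^ 2 * (M : ℝ) / (N : ℝ) ^ 2 ≤ C / (M : ℝ) := by
      rw [div_le_div_iff₀ hN2 hMposR]
      have hsq : ((k : ℝ) * (M : ℝ)) ^ 2 ≤ (N : ℝ) ^ 2 :=
        pow_le_pow_left₀ (by positivity) hkMR 2
      calc C * (k : ℝ) ^ 2 * (M : ℝ) * (M : ℝ) = C * ((k : ℝ) * (M : ℝ)) ^ 2 := by ring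
        _ ≤ C * (N : ℝ) ^ 2 := mul_le_mul_of_nonneg_left hsq hC
    calc a N / (N : ℝ) ^ 2
        ≤ ((k : ℝ) ^ 2 * a M + C * (k : ℝ) ^ 2 * (M : ℝ) + C * (N : ℝ)) / (N : ℝ) ^ 2 :=
          div_le_div_of_nonneg_right (h1.trans (by linarith)) hN2.le
      _ = (k : ℝ) ^ 2 * a M / (N : ℝ) ^ 2 + C * (k : ℝ) ^ 2 * (M : ℝ) / (N : ℝ) ^ 2 +
            C / (N : ℝ) := by
          field_simp
      _ ≤ (k : ℝ) ^ 2 * a M / (N : ℝ) ^ 2 + C / (M : ℝ) + C / (N : ℝ) := by linarith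
      _ = (((k * M : ℕ) : ℝ) / (N : ℝ)) ^ 2 * (a M / (M : ℝ) ^ 2) + C / (M : ℝ) + C / (N : ℝ) := by
          rw [Nat.cast_mul]
          field_simp

end Summit.HubbardSuperconductivity.HubbardSuperconductivity.Theorems
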